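import Summits.QuantumFields.YangMills.Theorems.BalabanUVNodesN15CurvedGluingCubeSmoothCutAdjointLetter
import HarnessLib

/-!
# THE TWO-SPACING η-DEFECT OF THE ADJOINT FORM's RESOLVENT LETTER `𝔇(𝒲′, 𝒲)` — FILE 150's twin along King's pairing: by parts onto the defects of the flat cube's cut row (`m₀`), of its
# SANDWICHED right entries (`m^Q`), the coefficients' two-grid fits (`o_C, o_A, o_∇`), the base part's defect (`r_N`) and the bump's fit (`o_t`); block-aligned sharp cuts have NO defect
# (dag-n15-c g18, FILE 151; N15 = NE2, s1 «background-layer OPERATOR ingredient»)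

Cell `pub-ymgap`, seat `pub-ymgap-dag-n15-c` (R134 (a); HUMAN RULING D-0062), generation 18.  `bears_on: R4∕N15 · K3⁸ SpineGivenEndpointR13SepCoPHV (stmt-QuantumFields-27366)`.
Filed `--kind proof --supports stmt-QuantumFields-27366 --as helper` — COUNT-NEUTRAL.  Theorems only; 0 `def`, 0 `sorry`.  Imports BY NAME FILE 150 `…CubeSmoothCutAdjointLetter` (`adjW_eq`,
`hasMaj_adjBracket`, `hasMaj_comp_mmulOp_mulOp`, `hasMaj_comp_mulOp_mmulOp`, `loc₂_le_plain`, `exp_rate_mono`; through it FILE 148, n15-c `hasMaj_idef_mmulOp`, `fgradMat`, file 24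
`idef_out_in`, `mulOp_eq_zero_of_vanish`, FILE 45 `idef_fsum`, lit `idef_comp`∕`idef_add`∕`idef_sub`, `hasMaj_idef_mulOp`, `hasMaj_comp_exp`).  Nothing in the tree is modified.

WHY.  FILE 148's two-grid theorems (`hasMaj_idef_projO_dressedV_comp_adj(_loc₂)`, `hasMaj_idef_neumannR_comp_loc₂`) read the dressed cube's η-defects through `hDW : 𝔇(𝒲′, 𝒲) ≤ re^{−δd}`.
By FILE 150 `adjW_eq`, `𝒲 = M_χ̃∘B` with the bracket `B` a finite sum of products of displayed letters; the lit Leibniz rule `𝔇(T′Z′, TZ) = T′𝔇(Z′,Z) + 𝔇(T′,T)Z` reduces `𝔇(B′, B)` to: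
the two-grid defects of the cut flat cube `𝔇(M_{χ′}N′, M_χN)` (`m₀`) and of the cut sandwiched operators `𝔇(M_{χ′}T′^±, M_χT^±)` (`m^Q` — dag-n15-a N-IIn (c)⁻ ∕ N-IIr (c)⁺ at the cover),
the coefficients' ROW FITS (`o_C`, translated `o_A`, differenced `o_∇`: n15-c `hasMaj_idef_mmulOp(_translate)`), the base part's defect (`r_N`), and the bump's fit `|χ̃′ − χ̃∘π| ≤ o_t`.  The
sharp cuts `χ, χ′` are BLOCK-ALIGNED at the cover (`χ′ = χ∘π`: indicators of unions of coarse blocks), so `𝔇(M_{χ′}, M_χ) = 0` EXACTLY (`idef_mulOp_aligned`) — no boundary-layer term.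

WHAT.  §1 `idef_mulOp_aligned`, ★ `hasMaj_idef_comp_mmulOp_mulOp`, ★ `hasMaj_idef_comp_mulOp_mmulOp` (two-grid twins of FILE 150's product rows), ★ `hasMaj_idef_comp_base`.  §2 ★★
`hasMaj_idef_adjBracket` (`𝔇(B′,B) ≤ [(βo_C + m₀r_C) + |J|·2((β^Qo_A + m^Qr_A) + (βo_∇ + m₀r_∇)) + (βr_N + m₀R_N)c_r]·e^{−ρd}`).  §3 ★★★ `hasMaj_idef_adjW_smoothCut_loc₂` (`𝔇(𝒲′,𝒲) ≤
1_S1_S·(K_DB + o_t·K_B)·e^{−ρd}`, `K_B` = FILE 150's constant; FILE 148's `hDW`, two-sided), ★ `hasMaj_idef_adjW_smoothCut` (plain).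

HONEST FRAMING ∕ LIMITS.  Lit Leibniz for `idef` + block-majorant bookkeeping over DISPLAYED letters at both grids; proves NO estimate of any concrete propagator; nothing of [B5]∕[B6]∕[B9]
asserted ((2.133)–(2.135) p.247, (3.52) p.400, (3.62)–(3.65) pp.402–403 = SHAPES; Thm 3.14 pp.426–427 = difference TEMPLATE).  NE2⁺ NOT PRINTED, NOT proved; N15 NOT discharged; K3⁸ OPEN,
skeleton v7 untouched (0∕2); counts of record UNMOVED (typed 28∕28 · discharged 6∕27 · A 6∕28); one finite 𝕋⁴ at fixed ε — NOT infinite volume, NOT OS on ℝ⁴, NOT a mass gap, NOT Clay; R4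
closes the conditional finite-𝕋⁴ rung `BalabanLadder.UV` only.  Restate-immune (no Theses import).
-/

set_option autoImplicit false

noncomputable section

open scoped BigOperators

namespace Summit.QuantumFields.YangMills.BalabanUVNodes.N15.Gluing

open Literature.MathematicalPhysics.QuantumFieldTheory.Balaban1983to89
open Literature.MathematicalPhysics.QuantumFieldTheory.Balaban1983to89.B11SectG (BlockNorm HasMaj RowSum hasMaj_comp_exp)
open Literature.MathematicalPhysics.QuantumFieldTheory.Balaban1983to89.B6RandomWalk (Triangle254)
open Literature.MathematicalPhysics.QuantumFieldTheory.Balaban1983to89.T4EtaRateDefect (idef idef_apply idef_comp idef_add idef_sub)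
open Literature.MathematicalPhysics.QuantumFieldTheory.Balaban1983to89.T4EtaRateCoeffDefect (pull pull_apply diagK diagK_nonneg hasMaj_mulOp hasMaj_idef_mulOp)
open Literature.MathematicalPhysics.QuantumFieldTheory.Balaban1983to89.B6Prop26Gluing (mulOp mulOp_apply ind ind_nonneg ind_le_one)
open Summit.QuantumFields.YangMills.BalabanUVNodes.N15.MatrixSpecies (mmulOp mmulOp_apply hasMaj_mmulOp hasMaj_idef_mmulOp liftBlk liftMap liftEquiv)
open Summit.QuantumFields.YangMills.BalabanUVNodes.N15.BackgroundLayer (fgrad bgrad stack projO unstackM fgradMat)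
open Summit.QuantumFields.YangMills.BalabanUVNodes.N15.CurvedSpecies (mulOp_eq_zero_of_vanish idef_out_in)

/-! ## §1 Two-grid twins of the product rows; aligned cuts have no defect -/

section Products

variable {X X' ι J : Type} [Fintype X] [Fintype X'] [Fintype ι] [Fintype J] {g : B6.Geometry} (blk : X → g.Site) (π : X' → X) {σ cr : ℝ} {χX : X → ℝ} {χX' : X' → ℝ}

omit [Fintype X] [Fintype X'] [Fintype ι] [Fintype J] in
/-- BLOCK-ALIGNED CUTS HAVE NO η-DEFECT: `χ′ = χ∘π` ⟹ `𝔇(M_{χ′}, M_χ) = 0`. [folklore] -/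
theorem idef_mulOp_aligned (hχπ : ∀ x', χX' x' = χX (π x')) :
    idef (pull (liftMap π ι)) (pull (liftMap π ι)) (mulOp (fun p : X' × ι => χX' p.1)) (mulOp (fun p : X × ι => χX p.1)) = 0 := by
  refine LinearMap.ext fun f => funext fun p => ?_
  simp only [idef_apply, Pi.sub_apply, LinearMap.zero_apply, Pi.zero_apply, mulOp_apply, pull_apply, liftMap, hχπ p.1, sub_self]

omit [Fintype J] in
/-- ★ **TWO-GRID TWIN OF `T∘(M_B∘M_χ)`**: fine `T′ ≤ ce^{−δd}`, `𝔇(T′,T) ≤ me^{−δd}`, coarse `Σ_j|B_{ij}| ≤ r_B`, fit `Σ_j|B′_{ij}(x′) − B_{ij}(πx′)| ≤ o_B`, `|χ| ≤ 1`, aligned cuts ⟹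
`𝔇(T′(M_{B′}M_{χ′}), T(M_BM_χ)) ≤ (c·o_B + m·r_B)·e^{−δd}`. [cite: Balaban1985BackgroundPropagators, Thm 3.14 pp.426–427 (difference template)] -/
theorem hasMaj_idef_comp_mmulOp_mulOp {T : (X × ι → ℝ) →ₗ[ℝ] (X × ι → ℝ)} {T' : (X' × ι → ℝ) →ₗ[ℝ] (X' × ι → ℝ)} {B : X → Matrix ι ι ℝ} {B' : X' → Matrix ι ι ℝ}
    {c m rB oB δ : ℝ} (hc : 0 ≤ c) (hm : 0 ≤ m) (hrB : 0 ≤ rB) (hoB : 0 ≤ oB) (hχ1 : ∀ x, |χX x| ≤ 1) (hχπ : ∀ x', χX' x' = χX (π x'))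
    (hB : ∀ x i, ∑ j, |B x i j| ≤ rB) (hfB : ∀ x' i, ∑ j, |B' x' i j - B (π x') i j| ≤ oB)
    (hT' : HasMaj (BlockNorm.ofBlocks g (liftBlk (blk ∘ π) ι)) (BlockNorm.ofBlocks g (liftBlk (blk ∘ π) ι)) T' (fun y y' => c * Real.exp (-(δ * g.dist y y'))))
    (hDT : HasMaj (BlockNorm.ofBlocks g (liftBlk blk ι)) (BlockNorm.ofBlocks g (liftBlk (blk ∘ π) ι)) (idef (pull (liftMap π ι)) (pull (liftMap π ι)) T' T)
      (fun y y' => m * Real.exp (-(δ * g.dist y y')))) :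
    HasMaj (BlockNorm.ofBlocks g (liftBlk blk ι)) (BlockNorm.ofBlocks g (liftBlk (blk ∘ π) ι))
      (idef (pull (liftMap π ι)) (pull (liftMap π ι)) (T' ∘ₗ (mmulOp B' ∘ₗ mulOp (fun p : X' × ι => χX' p.1))) (T ∘ₗ (mmulOp B ∘ₗ mulOp (fun p : X × ι => χX p.1))))
      (fun y y' => (c * oB + m * rB) * Real.exp (-(δ * g.dist y y'))) := by
  have hMχ := hasMaj_mulOp (g := g) (liftBlk blk ι) (m := fun _ => (1 : ℝ)) (fun _ => zero_le_one) (fun p : X × ι => hχ1 p.1)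
  have hMB := hasMaj_mmulOp blk (C := B) (fun _ => hrB) (fun x i => hB x i)
  have hDB := hasMaj_idef_mmulOp (ι := ι) blk π (C' := B') (C := B) (o := fun _ => oB) (fun _ => hoB) (fun x' i => hfB x' i)
  have hZ : idef (pull (liftMap π ι)) (pull (liftMap π ι)) (mmulOp B' ∘ₗ mulOp (fun p : X' × ι => χX' p.1)) (mmulOp B ∘ₗ mulOp (fun p : X × ι => χX p.1)) =
      idef (pull (liftMap π ι)) (pull (liftMap π ι)) (mmulOp B') (mmulOp B) ∘ₗ mulOp (fun p : X × ι => χX p.1) := by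
    rw [idef_comp (pull (liftMap π ι)) (pull (liftMap π ι)) (pull (liftMap π ι)), idef_mulOp_aligned π hχπ, LinearMap.comp_zero, zero_add]
  -- term 1: `T′ ∘ (𝔇(M_{B′},M_B) ∘ M_χ)`
  have t1a := hasMaj_comp_diag (liftBlk (blk ∘ π) ι) (fun a b => mul_nonneg hc (Real.exp_nonneg _)) hT' hDB
  have t1 := hasMaj_comp_diag (liftBlk blk ι) (fun a b => mul_nonneg (mul_nonneg hc (Real.exp_nonneg _)) hoB) t1a hMχ
  -- term 2: `𝔇(T′,T) ∘ (M_B ∘ M_χ)`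
  have t2a := hasMaj_comp_diag (liftBlk blk ι) (fun a b => mul_nonneg hm (Real.exp_nonneg _)) hDT hMB
  have t2 := hasMaj_comp_diag (liftBlk blk ι) (fun a b => mul_nonneg (mul_nonneg hm (Real.exp_nonneg _)) hrB) t2a hMχ
  rw [idef_comp (pull (liftMap π ι)) (pull (liftMap π ι)) (pull (liftMap π ι)), hZ]
  refine ((t1.congr fun _ => rfl).add (t2.congr fun _ => rfl)).mono fun y y' => le_of_eq ?_
  ring

omit [Fintype J] in
/-- ★ **TWO-GRID TWIN OF `T∘(M_χ∘M_B)`**: same letters ⟹ `𝔇(T′(M_{χ′}M_{B′}), T(M_χM_B)) ≤ (c·o_B + m·r_B)·e^{−δd}` (`|χ′| ≤ 1` fine). [cite: Balaban1985BackgroundPropagators, Thm 3.14 pp.426–427 (template)] -/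
theorem hasMaj_idef_comp_mulOp_mmulOp {T : (X × ι → ℝ) →ₗ[ℝ] (X × ι → ℝ)} {T' : (X' × ι → ℝ) →ₗ[ℝ] (X' × ι → ℝ)} {B : X → Matrix ι ι ℝ} {B' : X' → Matrix ι ι ℝ}
    {c m rB oB δ : ℝ} (hc : 0 ≤ c) (hm : 0 ≤ m) (hrB : 0 ≤ rB) (hoB : 0 ≤ oB) (hχ1 : ∀ x, |χX x| ≤ 1) (hχ1' : ∀ x', |χX' x'| ≤ 1) (hχπ : ∀ x', χX' x' = χX (π x'))
    (hB : ∀ x i, ∑ j, |B x i j| ≤ rB) (hfB : ∀ x' i, ∑ j, |B' x' i j - B (π x') i j| ≤ oB)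
    (hT' : HasMaj (BlockNorm.ofBlocks g (liftBlk (blk ∘ π) ι)) (BlockNorm.ofBlocks g (liftBlk (blk ∘ π) ι)) T' (fun y y' => c * Real.exp (-(δ * g.dist y y'))))
    (hDT : HasMaj (BlockNorm.ofBlocks g (liftBlk blk ι)) (BlockNorm.ofBlocks g (liftBlk (blk ∘ π) ι)) (idef (pull (liftMap π ι)) (pull (liftMap π ι)) T' T)
      (fun y y' => m * Real.exp (-(δ * g.dist y y')))) :
    HasMaj (BlockNorm.ofBlocks g (liftBlk blk ι)) (BlockNorm.ofBlocks g (liftBlk (blk ∘ π) ι))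
      (idef (pull (liftMap π ι)) (pull (liftMap π ι)) (T' ∘ₗ (mulOp (fun p : X' × ι => χX' p.1) ∘ₗ mmulOp B')) (T ∘ₗ (mulOp (fun p : X × ι => χX p.1) ∘ₗ mmulOp B)))
      (fun y y' => (c * oB + m * rB) * Real.exp (-(δ * g.dist y y'))) := by
  have hMχ := hasMaj_mulOp (g := g) (liftBlk blk ι) (m := fun _ => (1 : ℝ)) (fun _ => zero_le_one) (fun p : X × ι => hχ1 p.1)
  have hMχ' := hasMaj_mulOp (g := g) (liftBlk (blk ∘ π) ι) (m := fun _ => (1 : ℝ)) (fun _ => zero_le_one) (fun p : X' × ι => hχ1' p.1)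
  have hMB := hasMaj_mmulOp blk (C := B) (fun _ => hrB) (fun x i => hB x i)
  have hDB := hasMaj_idef_mmulOp (ι := ι) blk π (C' := B') (C := B) (o := fun _ => oB) (fun _ => hoB) (fun x' i => hfB x' i)
  have hZ : idef (pull (liftMap π ι)) (pull (liftMap π ι)) (mulOp (fun p : X' × ι => χX' p.1) ∘ₗ mmulOp B') (mulOp (fun p : X × ι => χX p.1) ∘ₗ mmulOp B) =
      mulOp (fun p : X' × ι => χX' p.1) ∘ₗ idef (pull (liftMap π ι)) (pull (liftMap π ι)) (mmulOp B') (mmulOp B) := by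
    rw [idef_comp (pull (liftMap π ι)) (pull (liftMap π ι)) (pull (liftMap π ι)), idef_mulOp_aligned π hχπ, LinearMap.zero_comp, add_zero]
  -- term 1: `T′ ∘ (M_{χ′} ∘ 𝔇(M_{B′},M_B))`
  have t1a := hasMaj_comp_diag (liftBlk (blk ∘ π) ι) (fun a b => mul_nonneg hc (Real.exp_nonneg _)) hT' hMχ'
  have t1 := hasMaj_comp_diag (liftBlk (blk ∘ π) ι) (fun a b => mul_nonneg (mul_nonneg hc (Real.exp_nonneg _)) zero_le_one) t1a hDB
  -- term 2: `𝔇(T′,T) ∘ (M_χ ∘ M_B)`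
  have t2a := hasMaj_comp_diag (liftBlk blk ι) (fun a b => mul_nonneg hm (Real.exp_nonneg _)) hDT hMχ
  have t2 := hasMaj_comp_diag (liftBlk blk ι) (fun a b => mul_nonneg (mul_nonneg hm (Real.exp_nonneg _)) zero_le_one) t2a hMB
  rw [idef_comp (pull (liftMap π ι)) (pull (liftMap π ι)) (pull (liftMap π ι)), hZ]
  refine ((t1.congr fun _ => rfl).add (t2.congr fun _ => rfl)).mono fun y y' => le_of_eq ?_
  ring

omit [Fintype J] in
/-- ★ **TWO-GRID TWIN OF THE BASE TERM `N_c∘(N_V∘M_χ)`**: fine `N_c′ ≤ βe^{−δd}`, `𝔇(N_c′,N_c) ≤ m₀e^{−δd}`, coarse `N_V ≤ R_Ne^{−δ_Nd}`, `𝔇(N_V′,N_V) ≤ r_Ne^{−δ_Nd}`, aligned cuts, a rate `ρ ≥ 0` with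
`ρ ≤ δ_N`, `ρ + σ ≤ δ` ⟹ `𝔇 ≤ (βr_N + m₀R_N)c_r·e^{−ρd}` (one row sum each). [cite: Balaban1984PropagatorsII, (2.52)–(2.56) pp.232–233 (mechanism); Balaban1985BackgroundPropagators, Thm 3.14 (template)] -/
theorem hasMaj_idef_comp_base (htri : Triangle254 g) (hd : ∀ a b : g.Site, 0 ≤ g.dist a b) (hrow : RowSum g σ cr) {Nc NV : (X × ι → ℝ) →ₗ[ℝ] (X × ι → ℝ)}
    {Nc' NV' : (X' × ι → ℝ) →ₗ[ℝ] (X' × ι → ℝ)} {β m₀ RN rN δ δN ρ : ℝ} (hβ : 0 ≤ β) (hm₀ : 0 ≤ m₀) (hRN : 0 ≤ RN) (hrN : 0 ≤ rN) (hρ : 0 ≤ ρ) (hρN : ρ ≤ δN) (hρσδ : ρ + σ ≤ δ)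
    (hχ1 : ∀ x, |χX x| ≤ 1) (hχπ : ∀ x', χX' x' = χX (π x'))
    (hN' : HasMaj (BlockNorm.ofBlocks g (liftBlk (blk ∘ π) ι)) (BlockNorm.ofBlocks g (liftBlk (blk ∘ π) ι)) Nc' (fun y y' => β * Real.exp (-(δ * g.dist y y'))))
    (hDN : HasMaj (BlockNorm.ofBlocks g (liftBlk blk ι)) (BlockNorm.ofBlocks g (liftBlk (blk ∘ π) ι)) (idef (pull (liftMap π ι)) (pull (liftMap π ι)) Nc' Nc)
      (fun y y' => m₀ * Real.exp (-(δ * g.dist y y'))))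
    (hNV : HasMaj (BlockNorm.ofBlocks g (liftBlk blk ι)) (BlockNorm.ofBlocks g (liftBlk blk ι)) NV (fun y y' => RN * Real.exp (-(δN * g.dist y y'))))
    (hDNV : HasMaj (BlockNorm.ofBlocks g (liftBlk blk ι)) (BlockNorm.ofBlocks g (liftBlk (blk ∘ π) ι)) (idef (pull (liftMap π ι)) (pull (liftMap π ι)) NV' NV)
      (fun y y' => rN * Real.exp (-(δN * g.dist y y')))) :
    HasMaj (BlockNorm.ofBlocks g (liftBlk blk ι)) (BlockNorm.ofBlocks g (liftBlk (blk ∘ π) ι))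
      (idef (pull (liftMap π ι)) (pull (liftMap π ι)) (Nc' ∘ₗ (NV' ∘ₗ mulOp (fun p : X' × ι => χX' p.1))) (Nc ∘ₗ (NV ∘ₗ mulOp (fun p : X × ι => χX p.1))))
      (fun y y' => (β * rN + m₀ * RN) * cr * Real.exp (-(ρ * g.dist y y'))) := by
  have hMχ := hasMaj_mulOp (g := g) (liftBlk blk ι) (m := fun _ => (1 : ℝ)) (fun _ => zero_le_one) (fun p : X × ι => hχ1 p.1)
  have hZ : idef (pull (liftMap π ι)) (pull (liftMap π ι)) (NV' ∘ₗ mulOp (fun p : X' × ι => χX' p.1)) (NV ∘ₗ mulOp (fun p : X × ι => χX p.1)) =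
      idef (pull (liftMap π ι)) (pull (liftMap π ι)) NV' NV ∘ₗ mulOp (fun p : X × ι => χX p.1) := by
    rw [idef_comp (pull (liftMap π ι)) (pull (liftMap π ι)) (pull (liftMap π ι)), idef_mulOp_aligned π hχπ, LinearMap.comp_zero, zero_add]
  have hDZ : HasMaj (BlockNorm.ofBlocks g (liftBlk blk ι)) (BlockNorm.ofBlocks g (liftBlk (blk ∘ π) ι)) (idef (pull (liftMap π ι)) (pull (liftMap π ι)) NV' NV ∘ₗ mulOp (fun p : X × ι => χX p.1))
      (fun y y' => rN * Real.exp (-(δN * g.dist y y'))) :=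
    (hasMaj_comp_diag (liftBlk blk ι) (fun a b => mul_nonneg hrN (Real.exp_nonneg _)) hDNV hMχ).mono fun y y' => le_of_eq (mul_one _)
  have hZc : HasMaj (BlockNorm.ofBlocks g (liftBlk blk ι)) (BlockNorm.ofBlocks g (liftBlk blk ι)) (NV ∘ₗ mulOp (fun p : X × ι => χX p.1)) (fun y y' => RN * Real.exp (-(δN * g.dist y y'))) :=
    (hasMaj_comp_diag (liftBlk blk ι) (fun a b => mul_nonneg hRN (Real.exp_nonneg _)) hNV hMχ).mono fun y y' => le_of_eq (mul_one _)
  have t1 := hasMaj_comp_exp (b₁ := BlockNorm.ofBlocks g (liftBlk blk ι)) (b₂ := BlockNorm.ofBlocks g (liftBlk (blk ∘ π) ι)) (b₃ := BlockNorm.ofBlocks g (liftBlk (blk ∘ π) ι))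
    (T₁ := Nc') (T₂ := idef (pull (liftMap π ι)) (pull (liftMap π ι)) NV' NV ∘ₗ mulOp (fun p : X × ι => χX p.1)) (ρ := ρ) htri hd hrow hβ hrN hρ hρN hρσδ hN' hDZ
  have t2 := hasMaj_comp_exp (b₁ := BlockNorm.ofBlocks g (liftBlk blk ι)) (b₂ := BlockNorm.ofBlocks g (liftBlk blk ι)) (b₃ := BlockNorm.ofBlocks g (liftBlk (blk ∘ π) ι))
    (T₁ := idef (pull (liftMap π ι)) (pull (liftMap π ι)) Nc' Nc) (T₂ := NV ∘ₗ mulOp (fun p : X × ι => χX p.1)) (ρ := ρ) htri hd hrow hm₀ hRN hρ hρN hρσδ hDN hZc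
  rw [idef_comp (pull (liftMap π ι)) (pull (liftMap π ι)) (pull (liftMap π ι)), hZ]
  refine (t1.add t2).mono fun y y' => le_of_eq ?_
  rw [show (BlockNorm.ofBlocks g (liftBlk (blk ∘ π) ι)).κ = 1 from rfl, show (BlockNorm.ofBlocks g (liftBlk blk ι)).κ = 1 from rfl]
  ring

end Products

/-! ## §2 The bracket's η-defect -/

section Bracket

variable {X X' ι J : Type} [Fintype X] [Fintype X'] [Fintype ι] [Fintype J] {g : B6.Geometry} (blk : X → g.Site) (π : X' → X) (τ : J → X ≃ X) (τ' : J → X' ≃ X') (n n' : ℝ)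
  {σ cr : ℝ} {χX : X → ℝ} {χX' : X' → ℝ} {C : X → Matrix ι ι ℝ} {C' : X' → Matrix ι ι ℝ} {A : J ⊕ J → X → Matrix ι ι ℝ} {A' : J ⊕ J → X' → Matrix ι ι ℝ}
  {Nc NV : (X × ι → ℝ) →ₗ[ℝ] (X × ι → ℝ)} {Nc' NV' : (X' × ι → ℝ) →ₗ[ℝ] (X' × ι → ℝ)} {Tfc Tbc : J → (X × ι → ℝ) →ₗ[ℝ] (X × ι → ℝ)}
  {Tfc' Tbc' : J → (X' × ι → ℝ) →ₗ[ℝ] (X' × ι → ℝ)}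

/-- ★★ **THE BRACKET's η-DEFECT**: fine plain letters `N_c′ ≤ β`, `T′^±_c ≤ β^Q`, two-grid defects `𝔇(N_c′,N_c) ≤ m₀`, `𝔇(T′^±_c,T^±_c) ≤ m^Q` (rate `δ`), coarse coefficient letters `r_C, r_A, r_∇`,
their fits `o_C` (`C`), `o_A` (translated `A^±`), `o_∇` (`fgradMat` letters), the base part `R_N, r_N` (rate `δ_N`), aligned cuts, `|χ|, |χ′| ≤ 1`, a rate `ρ` ⟹
`𝔇(B′, B) ≤ [(βo_C + m₀r_C) + |J|·2((β^Qo_A + m^Qr_A) + (βo_∇ + m₀r_∇)) + (βr_N + m₀R_N)c_r]·e^{−ρd}`. [cite: Balaban1985BackgroundPropagators, Thm 3.14 pp.426–427 (template), (3.52) p.400 (shape)] -/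
theorem hasMaj_idef_adjBracket (htri : Triangle254 g) (hd : ∀ a b : g.Site, 0 ≤ g.dist a b) (hrow : RowSum g σ cr) {ρ δ δN β βQ rC rA r₁ RN m₀ mQ oC oA o₁ rN : ℝ} (hβ : 0 ≤ β)
    (hβQ : 0 ≤ βQ) (hrC : 0 ≤ rC) (hrA : 0 ≤ rA) (hr₁ : 0 ≤ r₁) (hRN : 0 ≤ RN) (hm₀ : 0 ≤ m₀) (hmQ : 0 ≤ mQ) (hoC : 0 ≤ oC) (hoA : 0 ≤ oA) (ho₁ : 0 ≤ o₁) (hrN : 0 ≤ rN)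
    (hρ : 0 ≤ ρ) (hρδ : ρ ≤ δ) (hρσδ : ρ + σ ≤ δ) (hρN : ρ ≤ δN) (hχ1 : ∀ x, |χX x| ≤ 1) (hχ1' : ∀ x', |χX' x'| ≤ 1) (hχπ : ∀ x', χX' x' = χX (π x'))
    (hN' : HasMaj (BlockNorm.ofBlocks g (liftBlk (blk ∘ π) ι)) (BlockNorm.ofBlocks g (liftBlk (blk ∘ π) ι)) Nc' (fun y y' => β * Real.exp (-(δ * g.dist y y'))))
    (hDN : HasMaj (BlockNorm.ofBlocks g (liftBlk blk ι)) (BlockNorm.ofBlocks g (liftBlk (blk ∘ π) ι)) (idef (pull (liftMap π ι)) (pull (liftMap π ι)) Nc' Nc)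
      (fun y y' => m₀ * Real.exp (-(δ * g.dist y y'))))
    (hTf' : ∀ μ, HasMaj (BlockNorm.ofBlocks g (liftBlk (blk ∘ π) ι)) (BlockNorm.ofBlocks g (liftBlk (blk ∘ π) ι)) (Tfc' μ) (fun y y' => βQ * Real.exp (-(δ * g.dist y y'))))
    (hTb' : ∀ μ, HasMaj (BlockNorm.ofBlocks g (liftBlk (blk ∘ π) ι)) (BlockNorm.ofBlocks g (liftBlk (blk ∘ π) ι)) (Tbc' μ) (fun y y' => βQ * Real.exp (-(δ * g.dist y y'))))
    (hDTf : ∀ μ, HasMaj (BlockNorm.ofBlocks g (liftBlk blk ι)) (BlockNorm.ofBlocks g (liftBlk (blk ∘ π) ι)) (idef (pull (liftMap π ι)) (pull (liftMap π ι)) (Tfc' μ) (Tfc μ))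
      (fun y y' => mQ * Real.exp (-(δ * g.dist y y'))))
    (hDTb : ∀ μ, HasMaj (BlockNorm.ofBlocks g (liftBlk blk ι)) (BlockNorm.ofBlocks g (liftBlk (blk ∘ π) ι)) (idef (pull (liftMap π ι)) (pull (liftMap π ι)) (Tbc' μ) (Tbc μ))
      (fun y y' => mQ * Real.exp (-(δ * g.dist y y'))))
    (hC : ∀ x i, ∑ j, |C x i j| ≤ rC) (hAf : ∀ μ x i, ∑ j, |A (Sum.inl μ) x i j| ≤ rA) (hAb : ∀ μ x i, ∑ j, |A (Sum.inr μ) x i j| ≤ rA)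
    (hgAf : ∀ μ x i, ∑ j, |fgradMat n (τ μ) (A (Sum.inl μ)) x i j| ≤ r₁) (hgAb : ∀ μ x i, ∑ j, |fgradMat n (τ μ) (A (Sum.inr μ)) x i j| ≤ r₁)
    (hfC : ∀ x' i, ∑ j, |C' x' i j - C (π x') i j| ≤ oC)
    (hfAf : ∀ μ x' i, ∑ j, |A' (Sum.inl μ) ((τ' μ).symm x') i j - A (Sum.inl μ) ((τ μ).symm (π x')) i j| ≤ oA)
    (hfAb : ∀ μ x' i, ∑ j, |A' (Sum.inr μ) ((τ' μ) x') i j - A (Sum.inr μ) ((τ μ) (π x')) i j| ≤ oA)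
    (hfgAf : ∀ μ x' i, ∑ j, |fgradMat n' (τ' μ) (A' (Sum.inl μ)) ((τ' μ).symm x') i j - fgradMat n (τ μ) (A (Sum.inl μ)) ((τ μ).symm (π x')) i j| ≤ o₁)
    (hfgAb : ∀ μ x' i, ∑ j, |fgradMat n' (τ' μ) (A' (Sum.inr μ)) x' i j - fgradMat n (τ μ) (A (Sum.inr μ)) (π x') i j| ≤ o₁)
    (hNV : HasMaj (BlockNorm.ofBlocks g (liftBlk blk ι)) (BlockNorm.ofBlocks g (liftBlk blk ι)) NV (fun y y' => RN * Real.exp (-(δN * g.dist y y'))))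
    (hDNV : HasMaj (BlockNorm.ofBlocks g (liftBlk blk ι)) (BlockNorm.ofBlocks g (liftBlk (blk ∘ π) ι)) (idef (pull (liftMap π ι)) (pull (liftMap π ι)) NV' NV)
      (fun y y' => rN * Real.exp (-(δN * g.dist y y')))) :
    HasMaj (BlockNorm.ofBlocks g (liftBlk blk ι)) (BlockNorm.ofBlocks g (liftBlk (blk ∘ π) ι))
      (idef (pull (liftMap π ι)) (pull (liftMap π ι))
        (Nc' ∘ₗ (mmulOp C' ∘ₗ mulOp (fun p : X' × ι => χX' p.1)) +
          ∑ μ, ((Tfc' μ ∘ₗ (mulOp (fun p : X' × ι => χX' p.1) ∘ₗ mmulOp (A' (Sum.inl μ) ∘ (τ' μ).symm)) -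
              Nc' ∘ₗ (mmulOp (fgradMat n' (τ' μ) (A' (Sum.inl μ)) ∘ (τ' μ).symm) ∘ₗ mulOp (fun p : X' × ι => χX' p.1))) +
            (Tbc' μ ∘ₗ (mulOp (fun p : X' × ι => χX' p.1) ∘ₗ mmulOp (A' (Sum.inr μ) ∘ (τ' μ))) -
              Nc' ∘ₗ (mmulOp (fgradMat n' (τ' μ) (A' (Sum.inr μ))) ∘ₗ mulOp (fun p : X' × ι => χX' p.1)))) +
          Nc' ∘ₗ (NV' ∘ₗ mulOp (fun p : X' × ι => χX' p.1)))
        (Nc ∘ₗ (mmulOp C ∘ₗ mulOp (fun p : X × ι => χX p.1)) +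
          ∑ μ, ((Tfc μ ∘ₗ (mulOp (fun p : X × ι => χX p.1) ∘ₗ mmulOp (A (Sum.inl μ) ∘ (τ μ).symm)) -
              Nc ∘ₗ (mmulOp (fgradMat n (τ μ) (A (Sum.inl μ)) ∘ (τ μ).symm) ∘ₗ mulOp (fun p : X × ι => χX p.1))) +
            (Tbc μ ∘ₗ (mulOp (fun p : X × ι => χX p.1) ∘ₗ mmulOp (A (Sum.inr μ) ∘ (τ μ))) -
              Nc ∘ₗ (mmulOp (fgradMat n (τ μ) (A (Sum.inr μ))) ∘ₗ mulOp (fun p : X × ι => χX p.1)))) +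
          Nc ∘ₗ (NV ∘ₗ mulOp (fun p : X × ι => χX p.1))))
      (fun y y' => ((β * oC + m₀ * rC) + Fintype.card J * (2 * ((βQ * oA + mQ * rA) + (β * o₁ + m₀ * r₁))) + (β * rN + m₀ * RN) * cr) * Real.exp (-(ρ * g.dist y y'))) := by
  have t1 := hasMaj_idef_comp_mmulOp_mulOp blk π hβ hm₀ hrC hoC hχ1 hχπ hC hfC hN' hDN
  have tμ : ∀ μ, HasMaj (BlockNorm.ofBlocks g (liftBlk blk ι)) (BlockNorm.ofBlocks g (liftBlk (blk ∘ π) ι))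
      (idef (pull (liftMap π ι)) (pull (liftMap π ι))
        ((Tfc' μ ∘ₗ (mulOp (fun p : X' × ι => χX' p.1) ∘ₗ mmulOp (A' (Sum.inl μ) ∘ (τ' μ).symm)) -
            Nc' ∘ₗ (mmulOp (fgradMat n' (τ' μ) (A' (Sum.inl μ)) ∘ (τ' μ).symm) ∘ₗ mulOp (fun p : X' × ι => χX' p.1))) +
          (Tbc' μ ∘ₗ (mulOp (fun p : X' × ι => χX' p.1) ∘ₗ mmulOp (A' (Sum.inr μ) ∘ (τ' μ))) -
            Nc' ∘ₗ (mmulOp (fgradMat n' (τ' μ) (A' (Sum.inr μ))) ∘ₗ mulOp (fun p : X' × ι => χX' p.1))))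
        ((Tfc μ ∘ₗ (mulOp (fun p : X × ι => χX p.1) ∘ₗ mmulOp (A (Sum.inl μ) ∘ (τ μ).symm)) -
            Nc ∘ₗ (mmulOp (fgradMat n (τ μ) (A (Sum.inl μ)) ∘ (τ μ).symm) ∘ₗ mulOp (fun p : X × ι => χX p.1))) +
          (Tbc μ ∘ₗ (mulOp (fun p : X × ι => χX p.1) ∘ₗ mmulOp (A (Sum.inr μ) ∘ (τ μ))) -
            Nc ∘ₗ (mmulOp (fgradMat n (τ μ) (A (Sum.inr μ))) ∘ₗ mulOp (fun p : X × ι => χX p.1)))))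
      (fun y y' => 2 * ((βQ * oA + mQ * rA) + (β * o₁ + m₀ * r₁)) * Real.exp (-(δ * g.dist y y'))) := fun μ => by
    have a1 := hasMaj_idef_comp_mulOp_mmulOp blk π (B := A (Sum.inl μ) ∘ (τ μ).symm) (B' := A' (Sum.inl μ) ∘ (τ' μ).symm) hβQ hmQ hrA hoA hχ1 hχ1' hχπ
      (fun x i => hAf μ ((τ μ).symm x) i) (fun x' i => hfAf μ x' i) (hTf' μ) (hDTf μ)
    have a2 := hasMaj_idef_comp_mmulOp_mulOp blk π (B := fgradMat n (τ μ) (A (Sum.inl μ)) ∘ (τ μ).symm) (B' := fgradMat n' (τ' μ) (A' (Sum.inl μ)) ∘ (τ' μ).symm) hβ hm₀ hr₁ ho₁ hχ1 hχπ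
      (fun x i => hgAf μ ((τ μ).symm x) i) (fun x' i => hfgAf μ x' i) hN' hDN
    have b1 := hasMaj_idef_comp_mulOp_mmulOp blk π (B := A (Sum.inr μ) ∘ (τ μ)) (B' := A' (Sum.inr μ) ∘ (τ' μ)) hβQ hmQ hrA hoA hχ1 hχ1' hχπ
      (fun x i => hAb μ ((τ μ) x) i) (fun x' i => hfAb μ x' i) (hTb' μ) (hDTb μ)
    have b2 := hasMaj_idef_comp_mmulOp_mulOp blk π (B := fgradMat n (τ μ) (A (Sum.inr μ))) (B' := fgradMat n' (τ' μ) (A' (Sum.inr μ))) hβ hm₀ hr₁ ho₁ hχ1 hχπ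
      (fun x i => hgAb μ x i) (fun x' i => hfgAb μ x' i) hN' hDN
    rw [idef_add, idef_sub, idef_sub]
    refine ((a1.sub a2).add (b1.sub b2)).mono fun y y' => le_of_eq ?_
    ring
  have tsum : HasMaj (BlockNorm.ofBlocks g (liftBlk blk ι)) (BlockNorm.ofBlocks g (liftBlk (blk ∘ π) ι)) _ _ :=
    (hasMaj_fsum (b₁ := BlockNorm.ofBlocks g (liftBlk blk ι)) (b₃ := BlockNorm.ofBlocks g (liftBlk (blk ∘ π) ι)) Finset.univ _ _ fun μ _ => tμ μ)
  have t3 := hasMaj_idef_comp_base blk π htri hd hrow hβ hm₀ hRN hrN hρ hρN hρσδ hχ1 hχπ hN' hDN hNV hDNV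
  rw [idef_add, idef_add, idef_fsum]
  refine ((t1.add tsum).add t3).mono fun y y' => ?_
  rw [Finset.sum_const, Finset.card_univ, nsmul_eq_mul]
  have e1 := exp_rate_mono hd (c := β * oC + m₀ * rC) (by positivity) hρδ y y'
  have e2 := exp_rate_mono hd (c := Fintype.card J * (2 * ((βQ * oA + mQ * rA) + (β * o₁ + m₀ * r₁)))) (by positivity) hρδ y y'
  nlinarith [e1, e2, Real.exp_nonneg (-(ρ * g.dist y y'))]

end Bracket

/-! ## §3 The letter's η-defect: the bump in front, two-sided localization -/

section Letter

variable {X X' ι J : Type} [Fintype X] [Fintype X'] [Fintype ι] [Fintype J] {g : B6.Geometry} (blk : X → g.Site) (π : X' → X) (τ : J → X ≃ X) (τ' : J → X' ≃ X') (n n' : ℝ)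
  {σ cr : ℝ} {χX χtX : X → ℝ} {χX' χtX' : X' → ℝ} {S : Set g.Site} {C : X → Matrix ι ι ℝ} {C' : X' → Matrix ι ι ℝ} {A : J ⊕ J → X → Matrix ι ι ℝ}
  {A' : J ⊕ J → X' → Matrix ι ι ℝ} {N NV : (X × ι → ℝ) →ₗ[ℝ] (X × ι → ℝ)} {N' NV' : (X' × ι → ℝ) →ₗ[ℝ] (X' × ι → ℝ)} {Tf Tb : J → (X × ι → ℝ) →ₗ[ℝ] (X × ι → ℝ)}
  {Tf' Tb' : J → (X' × ι → ℝ) →ₗ[ℝ] (X' × ι → ℝ)}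

/-- ★★★ **THE TWO-SPACING η-DEFECT OF THE ADJOINT FORM's RESOLVENT LETTER, TWO-SIDED LOCALIZED** (FILE 148's `hDW`): FILE 150's data at BOTH grids (cut rows of `N`, `N′` (`β`), sandwiched
right entries `T^±`, `T′^±` (`β^Q`), coefficient letters at the coarse grid, the coarse base part), the two-grid defects of the cut cube `𝔇(M_{χ′}N′, M_χN) ≤ 1_S1_S·m₀`, of the cut sandwiched operators
`𝔇(M_{χ′}T′^±, M_χT^±) ≤ 1_S1_S·m^Q`, of the base part `𝔇(N_V′, N_V) ≤ r_N`, the coefficient fits `o_C, o_A, o_∇`, the bump's fit `|χ̃′ − χ̃∘π| ≤ o_t`, block-aligned sharp cuts `χ′ = χ∘π` with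
`M_χM_χ = M_χ` ⟹ `𝔇(𝒲′, 𝒲) ≤ 1_S(y)1_S(y′)·(K_DB + o_t·K_B)·e^{−ρd}`, `K_B = βr_C + |J|·2(β^Qr_A + βr_∇) + βR_Nc_r`, `K_DB = (βo_C + m₀r_C) + |J|·2((β^Qo_A + m^Qr_A) + (βo_∇ + m₀r_∇)) +
(βr_N + m₀R_N)c_r`. [cite: Balaban1985BackgroundPropagators, Thm 3.14 pp.426–427 (difference template), (3.52) p.400, (3.62)–(3.65) pp.402–403 (shapes); Balaban1984PropagatorsII, (2.133)–(2.135) p.247] -/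
theorem hasMaj_idef_adjW_smoothCut_loc₂ (htri : Triangle254 g) (hd : ∀ a b : g.Site, 0 ≤ g.dist a b) (hrow : RowSum g σ cr)
    {ρ δ δN β βQ rC rA r₁ RN m₀ mQ oC oA o₁ rN ot : ℝ} (hβ : 0 ≤ β) (hβQ : 0 ≤ βQ) (hrC : 0 ≤ rC) (hrA : 0 ≤ rA) (hr₁ : 0 ≤ r₁) (hRN : 0 ≤ RN) (hm₀ : 0 ≤ m₀) (hmQ : 0 ≤ mQ)
    (hoC : 0 ≤ oC) (hoA : 0 ≤ oA) (ho₁ : 0 ≤ o₁) (hrN : 0 ≤ rN) (hot : 0 ≤ ot) (hcr : 0 ≤ cr) (hρ : 0 ≤ ρ) (hρδ : ρ ≤ δ) (hρσδ : ρ + σ ≤ δ) (hρN : ρ ≤ δN)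
    -- cuts at both grids
    (hSχ : ∀ x, χX x ≠ 0 → blk x ∈ S) (hSχ' : ∀ x', χX' x' ≠ 0 → blk (π x') ∈ S) (hχt' : ∀ x', |χtX' x'| ≤ 1) (hχ1 : ∀ x, |χX x| ≤ 1) (hχ1' : ∀ x', |χX' x'| ≤ 1)
    (hχπ : ∀ x', χX' x' = χX (π x')) (hfit : ∀ x', |χtX' x' - χtX (π x')| ≤ ot)
    (hsub : mulOp (fun p : X × ι => χtX p.1) ∘ₗ mulOp (fun p : X × ι => χX p.1) = mulOp (fun p : X × ι => χtX p.1))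
    (hsub' : mulOp (fun p : X' × ι => χtX' p.1) ∘ₗ mulOp (fun p : X' × ι => χX' p.1) = mulOp (fun p : X' × ι => χtX' p.1))
    (hχ : mulOp (fun p : X × ι => χX p.1) ∘ₗ mulOp (fun p : X × ι => χtX p.1) = mulOp (fun p : X × ι => χtX p.1))
    (hχ' : mulOp (fun p : X' × ι => χX' p.1) ∘ₗ mulOp (fun p : X' × ι => χtX' p.1) = mulOp (fun p : X' × ι => χtX' p.1))
    (hχχ : mulOp (fun p : X × ι => χX p.1) ∘ₗ mulOp (fun p : X × ι => χX p.1) = mulOp (fun p : X × ι => χX p.1))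
    (hχχ' : mulOp (fun p : X' × ι => χX' p.1) ∘ₗ mulOp (fun p : X' × ι => χX' p.1) = mulOp (fun p : X' × ι => χX' p.1))
    -- the flat cube: cut rows at both grids, defect
    (hcut : HasMaj (BlockNorm.ofBlocks g (liftBlk blk ι)) (BlockNorm.ofBlocks g (liftBlk blk ι)) (mulOp (fun p : X × ι => χX p.1) ∘ₗ N) (fun y y' => ind S y * ind S y' * (β * Real.exp (-(δ * g.dist y y')))))
    (hcut' : HasMaj (BlockNorm.ofBlocks g (liftBlk (blk ∘ π) ι)) (BlockNorm.ofBlocks g (liftBlk (blk ∘ π) ι)) (mulOp (fun p : X' × ι => χX' p.1) ∘ₗ N')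
      (fun y y' => ind S y * ind S y' * (β * Real.exp (-(δ * g.dist y y')))))
    (hIcut : HasMaj (BlockNorm.ofBlocks g (liftBlk blk ι)) (BlockNorm.ofBlocks g (liftBlk (blk ∘ π) ι))
      (idef (pull (liftMap π ι)) (pull (liftMap π ι)) (mulOp (fun p : X' × ι => χX' p.1) ∘ₗ N') (mulOp (fun p : X × ι => χX p.1) ∘ₗ N)) (fun y y' => ind S y * ind S y' * (m₀ * Real.exp (-(δ * g.dist y y')))))
    -- the sandwiched right entries at both grids, their defects
    (hTf : ∀ μ, N ∘ₗ fgrad n (liftEquiv (τ μ) ι) ∘ₗ mulOp (fun p : X × ι => χX p.1) = Tf μ ∘ₗ mulOp (fun p : X × ι => χX p.1))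
    (hTb : ∀ μ, N ∘ₗ bgrad n (liftEquiv (τ μ) ι) ∘ₗ mulOp (fun p : X × ι => χX p.1) = Tb μ ∘ₗ mulOp (fun p : X × ι => χX p.1))
    (hTf2 : ∀ μ, N' ∘ₗ fgrad n' (liftEquiv (τ' μ) ι) ∘ₗ mulOp (fun p : X' × ι => χX' p.1) = Tf' μ ∘ₗ mulOp (fun p : X' × ι => χX' p.1))
    (hTb2 : ∀ μ, N' ∘ₗ bgrad n' (liftEquiv (τ' μ) ι) ∘ₗ mulOp (fun p : X' × ι => χX' p.1) = Tb' μ ∘ₗ mulOp (fun p : X' × ι => χX' p.1))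
    (hTfr : ∀ μ, HasMaj (BlockNorm.ofBlocks g (liftBlk blk ι)) (BlockNorm.ofBlocks g (liftBlk blk ι)) (Tf μ) (fun y y' => ind S y * ind S y' * (βQ * Real.exp (-(δ * g.dist y y')))))
    (hTbr : ∀ μ, HasMaj (BlockNorm.ofBlocks g (liftBlk blk ι)) (BlockNorm.ofBlocks g (liftBlk blk ι)) (Tb μ) (fun y y' => ind S y * ind S y' * (βQ * Real.exp (-(δ * g.dist y y')))))
    (hTfr' : ∀ μ, HasMaj (BlockNorm.ofBlocks g (liftBlk (blk ∘ π) ι)) (BlockNorm.ofBlocks g (liftBlk (blk ∘ π) ι)) (Tf' μ) (fun y y' => ind S y * ind S y' * (βQ * Real.exp (-(δ * g.dist y y')))))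
    (hTbr' : ∀ μ, HasMaj (BlockNorm.ofBlocks g (liftBlk (blk ∘ π) ι)) (BlockNorm.ofBlocks g (liftBlk (blk ∘ π) ι)) (Tb' μ) (fun y y' => ind S y * ind S y' * (βQ * Real.exp (-(δ * g.dist y y')))))
    (hITf : ∀ μ, HasMaj (BlockNorm.ofBlocks g (liftBlk blk ι)) (BlockNorm.ofBlocks g (liftBlk (blk ∘ π) ι))
      (idef (pull (liftMap π ι)) (pull (liftMap π ι)) (mulOp (fun p : X' × ι => χX' p.1) ∘ₗ Tf' μ) (mulOp (fun p : X × ι => χX p.1) ∘ₗ Tf μ)) (fun y y' => ind S y * ind S y' * (mQ * Real.exp (-(δ * g.dist y y')))))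
    (hITb : ∀ μ, HasMaj (BlockNorm.ofBlocks g (liftBlk blk ι)) (BlockNorm.ofBlocks g (liftBlk (blk ∘ π) ι))
      (idef (pull (liftMap π ι)) (pull (liftMap π ι)) (mulOp (fun p : X' × ι => χX' p.1) ∘ₗ Tb' μ) (mulOp (fun p : X × ι => χX p.1) ∘ₗ Tb μ)) (fun y y' => ind S y * ind S y' * (mQ * Real.exp (-(δ * g.dist y y')))))
    -- coefficient letters (coarse) and fits
    (hC : ∀ x i, ∑ j, |C x i j| ≤ rC) (hAf : ∀ μ x i, ∑ j, |A (Sum.inl μ) x i j| ≤ rA) (hAb : ∀ μ x i, ∑ j, |A (Sum.inr μ) x i j| ≤ rA)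
    (hgAf : ∀ μ x i, ∑ j, |fgradMat n (τ μ) (A (Sum.inl μ)) x i j| ≤ r₁) (hgAb : ∀ μ x i, ∑ j, |fgradMat n (τ μ) (A (Sum.inr μ)) x i j| ≤ r₁)
    (hfC : ∀ x' i, ∑ j, |C' x' i j - C (π x') i j| ≤ oC)
    (hfAf : ∀ μ x' i, ∑ j, |A' (Sum.inl μ) ((τ' μ).symm x') i j - A (Sum.inl μ) ((τ μ).symm (π x')) i j| ≤ oA)
    (hfAb : ∀ μ x' i, ∑ j, |A' (Sum.inr μ) ((τ' μ) x') i j - A (Sum.inr μ) ((τ μ) (π x')) i j| ≤ oA)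
    (hfgAf : ∀ μ x' i, ∑ j, |fgradMat n' (τ' μ) (A' (Sum.inl μ)) ((τ' μ).symm x') i j - fgradMat n (τ μ) (A (Sum.inl μ)) ((τ μ).symm (π x')) i j| ≤ o₁)
    (hfgAb : ∀ μ x' i, ∑ j, |fgradMat n' (τ' μ) (A' (Sum.inr μ)) x' i j - fgradMat n (τ μ) (A (Sum.inr μ)) (π x') i j| ≤ o₁)
    -- base part at both grids, defect
    (hNV : HasMaj (BlockNorm.ofBlocks g (liftBlk blk ι)) (BlockNorm.ofBlocks g (liftBlk blk ι)) NV (fun y y' => RN * Real.exp (-(δN * g.dist y y'))))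
    (hDNV : HasMaj (BlockNorm.ofBlocks g (liftBlk blk ι)) (BlockNorm.ofBlocks g (liftBlk (blk ∘ π) ι)) (idef (pull (liftMap π ι)) (pull (liftMap π ι)) NV' NV)
      (fun y y' => rN * Real.exp (-(δN * g.dist y y')))) :
    HasMaj (BlockNorm.ofBlocks g (liftBlk blk ι)) (BlockNorm.ofBlocks g (liftBlk (blk ∘ π) ι))
      (idef (pull (liftMap π ι)) (pull (liftMap π ι))
        ((mulOp (fun p : X' × ι => χtX' p.1) ∘ₗ N') ∘ₗ (unstackM C' A' + NV' ∘ₗ projO (none : Option (J ⊕ J))) ∘ₗ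
          stack LinearMap.id (fun j => Sum.elim (fun μ => fgrad n' (liftEquiv (τ' μ) ι)) (fun μ => bgrad n' (liftEquiv (τ' μ) ι)) j) ∘ₗ mulOp (fun p : X' × ι => χX' p.1))
        ((mulOp (fun p : X × ι => χtX p.1) ∘ₗ N) ∘ₗ (unstackM C A + NV ∘ₗ projO (none : Option (J ⊕ J))) ∘ₗ
          stack LinearMap.id (fun j => Sum.elim (fun μ => fgrad n (liftEquiv (τ μ) ι)) (fun μ => bgrad n (liftEquiv (τ μ) ι)) j) ∘ₗ mulOp (fun p : X × ι => χX p.1)))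
      (fun y y' => ind S y * ind S y' *
        ((((β * oC + m₀ * rC) + Fintype.card J * (2 * ((βQ * oA + mQ * rA) + (β * o₁ + m₀ * r₁))) + (β * rN + m₀ * RN) * cr) +
          ot * (β * rC + Fintype.card J * (2 * (βQ * rA + β * r₁)) + β * RN * cr)) * Real.exp (-(ρ * g.dist y y')))) := by
  -- plain letters at both grids
  have hN0 : HasMaj (BlockNorm.ofBlocks g (liftBlk blk ι)) (BlockNorm.ofBlocks g (liftBlk blk ι)) (mulOp (fun p : X × ι => χX p.1) ∘ₗ N) (fun y y' => β * Real.exp (-(δ * g.dist y y'))) :=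
    hcut.mono fun y y' => loc₂_le_plain hβ y y'
  have hN0' : HasMaj (BlockNorm.ofBlocks g (liftBlk (blk ∘ π) ι)) (BlockNorm.ofBlocks g (liftBlk (blk ∘ π) ι)) (mulOp (fun p : X' × ι => χX' p.1) ∘ₗ N') (fun y y' => β * Real.exp (-(δ * g.dist y y'))) :=
    hcut'.mono fun y y' => loc₂_le_plain hβ y y'
  have hDN : HasMaj (BlockNorm.ofBlocks g (liftBlk blk ι)) (BlockNorm.ofBlocks g (liftBlk (blk ∘ π) ι))
      (idef (pull (liftMap π ι)) (pull (liftMap π ι)) (mulOp (fun p : X' × ι => χX' p.1) ∘ₗ N') (mulOp (fun p : X × ι => χX p.1) ∘ₗ N)) (fun y y' => m₀ * Real.exp (-(δ * g.dist y y'))) :=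
    hIcut.mono fun y y' => loc₂_le_plain hm₀ y y'
  have hTf0' : ∀ μ, HasMaj (BlockNorm.ofBlocks g (liftBlk (blk ∘ π) ι)) (BlockNorm.ofBlocks g (liftBlk (blk ∘ π) ι)) (mulOp (fun p : X' × ι => χX' p.1) ∘ₗ Tf' μ)
      (fun y y' => βQ * Real.exp (-(δ * g.dist y y'))) := fun μ =>
    (hasMaj_diag_comp (liftBlk (blk ∘ π) ι) (fun _ => zero_le_one) (hasMaj_mulOp (g := g) (liftBlk (blk ∘ π) ι) (m := fun _ => (1 : ℝ)) (fun _ => zero_le_one) (fun p : X' × ι => hχ1' p.1))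
      ((hTfr' μ).mono fun y y' => loc₂_le_plain hβQ y y')).mono fun y y' => le_of_eq (one_mul _)
  have hTb0' : ∀ μ, HasMaj (BlockNorm.ofBlocks g (liftBlk (blk ∘ π) ι)) (BlockNorm.ofBlocks g (liftBlk (blk ∘ π) ι)) (mulOp (fun p : X' × ι => χX' p.1) ∘ₗ Tb' μ)
      (fun y y' => βQ * Real.exp (-(δ * g.dist y y'))) := fun μ =>
    (hasMaj_diag_comp (liftBlk (blk ∘ π) ι) (fun _ => zero_le_one) (hasMaj_mulOp (g := g) (liftBlk (blk ∘ π) ι) (m := fun _ => (1 : ℝ)) (fun _ => zero_le_one) (fun p : X' × ι => hχ1' p.1))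
      ((hTbr' μ).mono fun y y' => loc₂_le_plain hβQ y y')).mono fun y y' => le_of_eq (one_mul _)
  have hTf0 : ∀ μ, HasMaj (BlockNorm.ofBlocks g (liftBlk blk ι)) (BlockNorm.ofBlocks g (liftBlk blk ι)) (mulOp (fun p : X × ι => χX p.1) ∘ₗ Tf μ)
      (fun y y' => βQ * Real.exp (-(δ * g.dist y y'))) := fun μ =>
    (hasMaj_diag_comp (liftBlk blk ι) (fun _ => zero_le_one) (hasMaj_mulOp (g := g) (liftBlk blk ι) (m := fun _ => (1 : ℝ)) (fun _ => zero_le_one) (fun p : X × ι => hχ1 p.1))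
      ((hTfr μ).mono fun y y' => loc₂_le_plain hβQ y y')).mono fun y y' => le_of_eq (one_mul _)
  have hTb0 : ∀ μ, HasMaj (BlockNorm.ofBlocks g (liftBlk blk ι)) (BlockNorm.ofBlocks g (liftBlk blk ι)) (mulOp (fun p : X × ι => χX p.1) ∘ₗ Tb μ)
      (fun y y' => βQ * Real.exp (-(δ * g.dist y y'))) := fun μ =>
    (hasMaj_diag_comp (liftBlk blk ι) (fun _ => zero_le_one) (hasMaj_mulOp (g := g) (liftBlk blk ι) (m := fun _ => (1 : ℝ)) (fun _ => zero_le_one) (fun p : X × ι => hχ1 p.1))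
      ((hTbr μ).mono fun y y' => loc₂_le_plain hβQ y y')).mono fun y y' => le_of_eq (one_mul _)
  have hDTf : ∀ μ, HasMaj (BlockNorm.ofBlocks g (liftBlk blk ι)) (BlockNorm.ofBlocks g (liftBlk (blk ∘ π) ι))
      (idef (pull (liftMap π ι)) (pull (liftMap π ι)) (mulOp (fun p : X' × ι => χX' p.1) ∘ₗ Tf' μ) (mulOp (fun p : X × ι => χX p.1) ∘ₗ Tf μ)) (fun y y' => mQ * Real.exp (-(δ * g.dist y y'))) :=
    fun μ => (hITf μ).mono fun y y' => loc₂_le_plain hmQ y y'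
  have hDTb : ∀ μ, HasMaj (BlockNorm.ofBlocks g (liftBlk blk ι)) (BlockNorm.ofBlocks g (liftBlk (blk ∘ π) ι))
      (idef (pull (liftMap π ι)) (pull (liftMap π ι)) (mulOp (fun p : X' × ι => χX' p.1) ∘ₗ Tb' μ) (mulOp (fun p : X × ι => χX p.1) ∘ₗ Tb μ)) (fun y y' => mQ * Real.exp (-(δ * g.dist y y'))) :=
    fun μ => (hITb μ).mono fun y y' => loc₂_le_plain hmQ y y'
  -- the sandwiches for the cut cubes at both grids
  have hTfc : ∀ μ, (mulOp (fun p : X × ι => χX p.1) ∘ₗ N) ∘ₗ fgrad n (liftEquiv (τ μ) ι) ∘ₗ mulOp (fun p : X × ι => χX p.1) =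
      (mulOp (fun p : X × ι => χX p.1) ∘ₗ Tf μ) ∘ₗ mulOp (fun p : X × ι => χX p.1) := fun μ => by rw [LinearMap.comp_assoc, hTf μ, ← LinearMap.comp_assoc]
  have hTbc : ∀ μ, (mulOp (fun p : X × ι => χX p.1) ∘ₗ N) ∘ₗ bgrad n (liftEquiv (τ μ) ι) ∘ₗ mulOp (fun p : X × ι => χX p.1) =
      (mulOp (fun p : X × ι => χX p.1) ∘ₗ Tb μ) ∘ₗ mulOp (fun p : X × ι => χX p.1) := fun μ => by rw [LinearMap.comp_assoc, hTb μ, ← LinearMap.comp_assoc]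
  have hTfc' : ∀ μ, (mulOp (fun p : X' × ι => χX' p.1) ∘ₗ N') ∘ₗ fgrad n' (liftEquiv (τ' μ) ι) ∘ₗ mulOp (fun p : X' × ι => χX' p.1) =
      (mulOp (fun p : X' × ι => χX' p.1) ∘ₗ Tf' μ) ∘ₗ mulOp (fun p : X' × ι => χX' p.1) := fun μ => by rw [LinearMap.comp_assoc, hTf2 μ, ← LinearMap.comp_assoc]
  have hTbc' : ∀ μ, (mulOp (fun p : X' × ι => χX' p.1) ∘ₗ N') ∘ₗ bgrad n' (liftEquiv (τ' μ) ι) ∘ₗ mulOp (fun p : X' × ι => χX' p.1) =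
      (mulOp (fun p : X' × ι => χX' p.1) ∘ₗ Tb' μ) ∘ₗ mulOp (fun p : X' × ι => χX' p.1) := fun μ => by rw [LinearMap.comp_assoc, hTb2 μ, ← LinearMap.comp_assoc]
  -- rewrite both letters as `M_χ̃ ∘ B`
  have hins : mulOp (fun p : X × ι => χtX p.1) ∘ₗ N = mulOp (fun p : X × ι => χtX p.1) ∘ₗ (mulOp (fun p : X × ι => χX p.1) ∘ₗ N) := by rw [← LinearMap.comp_assoc, hsub]
  have hins' : mulOp (fun p : X' × ι => χtX' p.1) ∘ₗ N' = mulOp (fun p : X' × ι => χtX' p.1) ∘ₗ (mulOp (fun p : X' × ι => χX' p.1) ∘ₗ N') := by rw [← LinearMap.comp_assoc, hsub']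
  -- the bracket at the coarse grid and its defect
  have hB := hasMaj_adjBracket blk τ n htri hd hrow hβ hβQ hrC hrA hr₁ hRN hρ hρδ hρσδ hρN hχ1 hN0 hTf0 hTb0 hC hAf hAb hgAf hgAb hNV
  have hDB := hasMaj_idef_adjBracket blk π τ τ' n n' htri hd hrow hβ hβQ hrC hrA hr₁ hRN hm₀ hmQ hoC hoA ho₁ hrN hρ hρδ hρσδ hρN hχ1 hχ1' hχπ hN0' hDN hTf0' hTb0' hDTf hDTb
    hC hAf hAb hgAf hgAb hfC hfAf hfAb hfgAf hfgAb hNV hDNV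
  -- the bump: `𝔇(M_χ̃′B′, M_χ̃B) = M_χ̃′𝔇(B′,B) + 𝔇(M_χ̃′,M_χ̃)B`
  have hMt' := hasMaj_mulOp (g := g) (liftBlk (blk ∘ π) ι) (m := fun _ => (1 : ℝ)) (fun _ => zero_le_one) (fun p : X' × ι => hχt' p.1)
  have hDt := hasMaj_idef_mulOp (g := g) (liftBlk blk ι) (liftMap π ι) (a' := fun p : X' × ι => χtX' p.1) (a := fun p : X × ι => χtX p.1) (o := fun _ => ot) (fun _ => hot)
    (fun p' => hfit p'.1)
  have key : HasMaj (BlockNorm.ofBlocks g (liftBlk blk ι)) (BlockNorm.ofBlocks g (liftBlk (blk ∘ π) ι))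
      (idef (pull (liftMap π ι)) (pull (liftMap π ι))
        ((mulOp (fun p : X' × ι => χtX' p.1) ∘ₗ N') ∘ₗ (unstackM C' A' + NV' ∘ₗ projO (none : Option (J ⊕ J))) ∘ₗ
          stack LinearMap.id (fun j => Sum.elim (fun μ => fgrad n' (liftEquiv (τ' μ) ι)) (fun μ => bgrad n' (liftEquiv (τ' μ) ι)) j) ∘ₗ mulOp (fun p : X' × ι => χX' p.1))
        ((mulOp (fun p : X × ι => χtX p.1) ∘ₗ N) ∘ₗ (unstackM C A + NV ∘ₗ projO (none : Option (J ⊕ J))) ∘ₗ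
          stack LinearMap.id (fun j => Sum.elim (fun μ => fgrad n (liftEquiv (τ μ) ι)) (fun μ => bgrad n (liftEquiv (τ μ) ι)) j) ∘ₗ mulOp (fun p : X × ι => χX p.1)))
      (fun y y' => (((β * oC + m₀ * rC) + Fintype.card J * (2 * ((βQ * oA + mQ * rA) + (β * o₁ + m₀ * r₁))) + (β * rN + m₀ * RN) * cr) +
          ot * (β * rC + Fintype.card J * (2 * (βQ * rA + β * r₁)) + β * RN * cr)) * Real.exp (-(ρ * g.dist y y'))) := by
    rw [hins, hins', adjW_eq τ n hTfc hTbc, adjW_eq τ' n' hTfc' hTbc', idef_comp (pull (liftMap π ι)) (pull (liftMap π ι)) (pull (liftMap π ι))]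
    have t1 := hasMaj_diag_comp (liftBlk (blk ∘ π) ι) (fun _ => zero_le_one) hMt' hDB
    have t2 := hasMaj_diag_comp (liftBlk blk ι) (fun _ => hot) hDt hB
    refine (t1.add t2).mono fun y y' => le_of_eq ?_
    ring
  -- two-sided localization at both grids
  have houtc : mulOp (fun p : X × ι => χX p.1) ∘ₗ ((mulOp (fun p : X × ι => χtX p.1) ∘ₗ N) ∘ₗ (unstackM C A + NV ∘ₗ projO (none : Option (J ⊕ J))) ∘ₗ
      stack LinearMap.id (fun j => Sum.elim (fun μ => fgrad n (liftEquiv (τ μ) ι)) (fun μ => bgrad n (liftEquiv (τ μ) ι)) j) ∘ₗ mulOp (fun p : X × ι => χX p.1)) =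
      (mulOp (fun p : X × ι => χtX p.1) ∘ₗ N) ∘ₗ (unstackM C A + NV ∘ₗ projO (none : Option (J ⊕ J))) ∘ₗ
        stack LinearMap.id (fun j => Sum.elim (fun μ => fgrad n (liftEquiv (τ μ) ι)) (fun μ => bgrad n (liftEquiv (τ μ) ι)) j) ∘ₗ mulOp (fun p : X × ι => χX p.1) := by
    simp only [← LinearMap.comp_assoc]
    rw [hχ]
  have houtf : mulOp (fun p : X' × ι => χX' p.1) ∘ₗ ((mulOp (fun p : X' × ι => χtX' p.1) ∘ₗ N') ∘ₗ (unstackM C' A' + NV' ∘ₗ projO (none : Option (J ⊕ J))) ∘ₗ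
      stack LinearMap.id (fun j => Sum.elim (fun μ => fgrad n' (liftEquiv (τ' μ) ι)) (fun μ => bgrad n' (liftEquiv (τ' μ) ι)) j) ∘ₗ mulOp (fun p : X' × ι => χX' p.1)) =
      (mulOp (fun p : X' × ι => χtX' p.1) ∘ₗ N') ∘ₗ (unstackM C' A' + NV' ∘ₗ projO (none : Option (J ⊕ J))) ∘ₗ
        stack LinearMap.id (fun j => Sum.elim (fun μ => fgrad n' (liftEquiv (τ' μ) ι)) (fun μ => bgrad n' (liftEquiv (τ' μ) ι)) j) ∘ₗ mulOp (fun p : X' × ι => χX' p.1) := by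
    simp only [← LinearMap.comp_assoc]
    rw [hχ']
  have hinc : ((mulOp (fun p : X × ι => χtX p.1) ∘ₗ N) ∘ₗ (unstackM C A + NV ∘ₗ projO (none : Option (J ⊕ J))) ∘ₗ
      stack LinearMap.id (fun j => Sum.elim (fun μ => fgrad n (liftEquiv (τ μ) ι)) (fun μ => bgrad n (liftEquiv (τ μ) ι)) j) ∘ₗ mulOp (fun p : X × ι => χX p.1)) ∘ₗ
      mulOp (fun p : X × ι => χX p.1) =
      (mulOp (fun p : X × ι => χtX p.1) ∘ₗ N) ∘ₗ (unstackM C A + NV ∘ₗ projO (none : Option (J ⊕ J))) ∘ₗ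
        stack LinearMap.id (fun j => Sum.elim (fun μ => fgrad n (liftEquiv (τ μ) ι)) (fun μ => bgrad n (liftEquiv (τ μ) ι)) j) ∘ₗ mulOp (fun p : X × ι => χX p.1) := by
    simp only [LinearMap.comp_assoc]
    rw [hχχ]
  have hinf : ((mulOp (fun p : X' × ι => χtX' p.1) ∘ₗ N') ∘ₗ (unstackM C' A' + NV' ∘ₗ projO (none : Option (J ⊕ J))) ∘ₗ
      stack LinearMap.id (fun j => Sum.elim (fun μ => fgrad n' (liftEquiv (τ' μ) ι)) (fun μ => bgrad n' (liftEquiv (τ' μ) ι)) j) ∘ₗ mulOp (fun p : X' × ι => χX' p.1)) ∘ₗ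
      mulOp (fun p : X' × ι => χX' p.1) =
      (mulOp (fun p : X' × ι => χtX' p.1) ∘ₗ N') ∘ₗ (unstackM C' A' + NV' ∘ₗ projO (none : Option (J ⊕ J))) ∘ₗ
        stack LinearMap.id (fun j => Sum.elim (fun μ => fgrad n' (liftEquiv (τ' μ) ι)) (fun μ => bgrad n' (liftEquiv (τ' μ) ι)) j) ∘ₗ mulOp (fun p : X' × ι => χX' p.1) := by
    simp only [LinearMap.comp_assoc]
    rw [hχχ']
  obtain ⟨hout, hin⟩ := idef_out_in blk π hSχ hSχ hSχ' hSχ' houtc hinc houtf hinf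
  exact hasMaj_localize (liftBlk blk ι) (liftBlk (blk ∘ π) ι) (fun a b => by positivity) hout hin key

end Letter

end Summit.QuantumFields.YangMills.BalabanUVNodes.N15.Gluing

end
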